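import Summits.QuantumFields.BalabanUV.Beta.D1BFx.CornerVBlockRank
import Summits.QuantumFields.BalabanUV.Beta.D1BFx.BlockColumnPoisson

/-!
# `BalabanUV.Beta.D1BFx.CornerColumnZeroMass` — road «BF-x» for binder row D1, slot (REST′), rows A3.a′∕A3.b′, STRUCTURE (the «Q-corner
# negligible» of the BLK-NUM engines in kernel form): THE TWO `Q̇`-SLOT COLUMNS OF `Rdot` — the block column `Σ_{z∈B(w)} P(z,q)` of the `V`-corner
# and the `kerP(q,w) = (G′Q′*C)(q,w)` column of the `Q̇`-corner — DIFFER, AT THE WEIGHT `cQ = a`, BY A ZERO-MASS COARSE SMEARING OF `kerP(q,·)`: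
# `a·Σ_{z∈B(w)} P(z,q) − kerP(q,w) = Σ_y (kerP(q,y) − kerP(q,w))·m(w,y)`, `m(w,y) = a·(Q′G′Q′*)(w,y) − δ_{wy}`, `Σ_y m(w,y) = 0`, and `m` IS the
# (block-constant) Poisson defect of the column `G′Q′*(·,w)`

HONEST DEPENDENCY (page 1, mandatory): continuum YM on T⁴ ⇐ BetaPertH ∧ nine spine estimates (0/9 proved); BetaPertH ⇐ (D1) ∧ (D4) ∧
CAP+tail; G-an2-4 gates asym, D1 and NE2/3/4.  HONEST FRAMING (cell contract, verbatim): «discharging `BetaPertH` makes Bałaban's UV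
stability UNCONDITIONAL — a real constructive-QFT result; it is NOT the continuum limit and NOT the Clay problem.»  THIS MODULE DISCHARGES
NOTHING of the wall: [folklore] `tsum` bookkeeping over leaf-09-g2's `RProjector` (`kerP`, `Pker`, `Pgt`, `summable_Pker`, `Pker_symm`), pv23's
`B6QGQLower276.kerQGQ` ∕ `B5Hk103ScalarZd` (`tsum_kerQGQ_row`, `gq`) ∕ `B6QGQDecay237.abs_kerQGQ_le_unif`, leaf-07-g3's `BlockColumnPoisson.tsum_lap_mul_gq`
and this lineage's `CornerVBlockRank` BY NAME; no `def`, no `def … : Prop`, nothing cited, 0 sorry.  0 wall binders; NOT the (REST′) word bounds,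
NOT (K), NOT the units check CHECK-N0 (`cQ = a` is DISPLAYED as the special value at which the cancellation is exact, not asserted of the road),
NOT D1, NOT `BetaPertH`, NOT continuum, NOT Clay.

LITERAL NOTE (row-D1 owner R-D1-g25-1 ∕ road owner ρ-g7-2 (d), 2026-08-21): these are the COMB-TERM (`σ = id`) needles; for the permutation-symmetrised
literal of record `JsB12Sym` the first-order averaging jet is the `S_D`-mean of the `D!` permuted needles (linear), so every identity below applies
summand by summand.

ABSOLUTE RULE (cell charter, verbatim): «No internally-minted statement may enter as a cited fact. Every hypothesis is either kernel-proved in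
this package or a verbatim quotation of a PUBLISHED theorem with page reference. The manuscript(s) under audit are NOT citable for their own
disputed steps — they are the thing under adjudication; programme-internal (2001/route/tribunal) claims are never citable.»

WHY (this lineage's BLK-NUM verdict v2, `HOME/b2b-balaban-beta-d1-formalise-leaf-04/g5/blknum/BLKNUM-RESULT.md`: «K-corner face-neutral, Q-corner
negligible, all growth in `cornerJ`»; `CornerVBlockRank.Rdot_apply_road`: every averaging-slot term of `Rdot n a cK cQ κ′ u` is the needle row
against the COMBINED column `cQ·Σ_{z∈B(blk u)} Pgt(z,q) − kerP (n−1) a q (blk u)`).  Both columns are `kerP(q,·)` smeared over the coarse lattice: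
`Σ_{z∈B(w)} Pgt(z,q) = Σ_y kerP(q,y)·(Q′G′Q′*)(w,y)` (`Pker_symm` + Fubini) and `kerP(q,w) = Σ_y kerP(q,y)·δ_{wy}`.  Hence the combined column at
`cQ = a` is `Σ_y kerP(q,y)·m(w,y)` with the weight `m(w,y) = a·(Q′G′Q′*)(w,y) − δ_{wy}`, whose coarse row sum VANISHES (`Σ_y (Q′G′Q′*)(w,y) = 1/a`,
pv23's `tsum_kerQGQ_row`): the column only sees block-to-block DIFFERENCES of `kerP(q,·)` around `w`; and `m(w,y)` is exactly MINUS the fine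
Laplacian `(n′)²(−Δ)` of the block column `G′Q′*(·,w)` read anywhere on the block `y` (leaf-07-g3's Poisson identity) — block-constant, bounded by
`δ_{wy} + a·c_u·e^{−δ_u|y−w|}`.  For `cQ ≠ a` the combined column is `(cQ − a)·Σ_{z∈B(w)} Pgt(z,q)` plus the zero-mass part (§5).

CONTENT (all [folklore]; road units: block side `n`, B6 index `n − 1`, `n′ := (n−1)+1`; `0 < a`):
* §1 `summable_kerP_mul_kerQGQ`, **`sum_B_Pgt_eq_tsum`** (`Σ_{z∈B(w)} Pgt n a z q = Σ'_y kerP (n−1) a q y · kerQGQ (n−1) a w y`), `kerP_eq_tsum_ite`.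
* §2 **`combinedColumn_eq_tsum`** (`a·Σ_{z∈B(w)} Pgt − kerP(q,w) = Σ'_y kerP(q,y)·(a·kerQGQ(w,y) − δ_{yw})`).
* §3 ZERO MASS: `summable_weight`, **`tsum_weight_eq_zero`** (`Σ'_y (a·kerQGQ(w,y) − δ_{yw}) = 0`), **`combinedColumn_eq_tsum_sub`**
  (`= Σ'_y (kerP(q,y) − kerP(q,w))·(a·kerQGQ(w,y) − δ_{yw})`).
* §4 THE WEIGHT IS THE POISSON DEFECT: **`weight_eq_neg_tsum_lap`** (`a·kerQGQ(w,y) − δ_{yw} = −Σ'_r (n′)²(−Δ)(p,r)·(G′Q′*)(r,w)` for every `p` in block `y`),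
  `abs_weight_le` (`≤ δ_{yw} + a·c_u·e^{−δ_u·dist(y,w)}`).
* §5 `combinedColumn_split` (general `cQ`: `cQ·colP − kerP = (cQ − a)·colP + (a·colP − kerP)`).
* §6 letters: `sum_B_abs_Pgt_le` ∕ `abs_sum_B_Pgt_le` (`|Σ_{z∈B(w)} Pgt(z,q)| ≤ (n′)⁴·c_PP·e^{−δ_PP·dist(w, blk q)}`), `abs_kerP_col_le`.
Provenance: D1 formalisation swarm, unit b2b-balaban-beta-d1-formalise-leaf-04 gen 6 (prover-b2b-balaban-beta-d1-formalise-leaf-04-g6-0), 2026-08-21;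
sub-leaf «D1-BFx-A3a′-NEEDLE» of `LEAVES-BFx.md` (FILE 4).
-/

namespace Summit.QuantumFields.BalabanUV.Beta.D1BFx.CornerColumnZeroMass

open Finset
open scoped BigOperators
open Literature.MathematicalPhysics.QuantumFieldTheory.Balaban1983to89
open Literature.MathematicalPhysics.QuantumFieldTheory.Balaban1983to89.Beta
open B6QGQLower276 (X blk B mem_B lapKer kerQGQ kerQGQ_symm)
open B6QGQDecay237 (cU deltaU cU_pos deltaU_pos abs_kerQGQ_le_unif)
open B5Hk103ScalarZd (gq tsum_kerQGQ_row summable_expX)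
open RProjector (kerP Pker Pgt Pgt_apply Pker_symm summable_Pker)
open BlockColumnPoisson (tsum_lap_mul_gq)

noncomputable section

variable (n : ℕ) [NeZero n] {a : ℝ}

/-! ## §1 Both columns are coarse smearings of `kerP(q, ·)` -/

omit [NeZero n] in
/-- [folklore] `y ↦ kerP(q,y)·(Q′G′Q′*)(w,y)` is summable (a finite block sum of the summable `y ↦ kerP(q,y)·(G′Q′*)(z,y)`, `summable_Pker`). -/
theorem summable_kerP_mul_kerQGQ (ha : 0 < a) (q w : X 4) :
    Summable fun y : X 4 => kerP (d := 4) (n - 1) a q y * kerQGQ (n - 1) a w y := by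
  have h : ∀ y : X 4, kerP (d := 4) (n - 1) a q y * kerQGQ (n - 1) a w y
      = ((((n - 1 : ℕ) : ℝ) + 1) ^ 4)⁻¹ * ∑ z ∈ B (n - 1) w, kerP (d := 4) (n - 1) a q y * gq (n - 1) a z y := by
    intro y
    rw [show kerQGQ (n - 1) a w y = ((((n - 1 : ℕ) : ℝ) + 1) ^ 4)⁻¹ * ∑ z ∈ B (n - 1) w, gq (n - 1) a z y from rfl,
      ← Finset.mul_sum]
    ring
  simp_rw [h]
  exact (summable_sum fun z _ => summable_Pker (n - 1) ha q z).mul_left _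

omit [NeZero n] in
/-- [folklore] **THE BLOCK COLUMN OF THE PROJECTOR IS A COARSE SMEARING OF `kerP`**: `Σ_{z∈B(w)} Pgt n a z q = Σ'_y kerP (n−1) a q y · (Q′G′Q′*)(w,y)`
(`Pker_symm`, then the series of `Pker` summed over the finite block). -/
theorem sum_B_Pgt_eq_tsum (ha : 0 < a) (q w : X 4) (v v' : Unit) :
    ∑ z ∈ B (n - 1) w, Pgt n a z q v v' = ∑' y : X 4, kerP (d := 4) (n - 1) a q y * kerQGQ (n - 1) a w y := by
  have h1 : ∀ z : X 4, Pgt n a z q v v'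
      = ((((n - 1 : ℕ) : ℝ) + 1) ^ 4)⁻¹ * ∑' y : X 4, kerP (d := 4) (n - 1) a q y * gq (n - 1) a z y := by
    intro z
    rw [Pgt_apply, Pker_symm (n - 1) ha z q, Pker]
  simp_rw [h1]
  rw [← Finset.mul_sum, ← Summable.tsum_finsetSum (fun z _ => summable_Pker (n - 1) ha q z)]
  have h2 : ∀ y : X 4, kerP (d := 4) (n - 1) a q y * kerQGQ (n - 1) a w y
      = ((((n - 1 : ℕ) : ℝ) + 1) ^ 4)⁻¹ * ∑ z ∈ B (n - 1) w, kerP (d := 4) (n - 1) a q y * gq (n - 1) a z y := by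
    intro y
    rw [show kerQGQ (n - 1) a w y = ((((n - 1 : ℕ) : ℝ) + 1) ^ 4)⁻¹ * ∑ z ∈ B (n - 1) w, gq (n - 1) a z y from rfl,
      ← Finset.mul_sum]
    ring
  simp_rw [h2]
  rw [tsum_mul_left]

omit [NeZero n] in
/-- [folklore] The `Q̇`-corner's column as the same kind of smearing against the Kronecker weight: `kerP(q,w) = Σ'_y kerP(q,y)·δ_{yw}`. -/
theorem kerP_eq_tsum_ite (q w : X 4) :
    kerP (d := 4) (n - 1) a q w = ∑' y : X 4, kerP (d := 4) (n - 1) a q y * (if y = w then 1 else 0) := by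
  classical
  rw [tsum_eq_single w (fun y hy => by rw [if_neg hy, mul_zero]), if_pos rfl, mul_one]

/-! ## §2 The combined column at the weight `cQ = a` -/

omit [NeZero n] in
/-- [folklore] **THE COMBINED COLUMN IS `kerP` SMEARED AGAINST THE WEIGHT `m(w,y) = a·(Q′G′Q′*)(w,y) − δ_{yw}`**:
`a·Σ_{z∈B(w)} Pgt n a z q − kerP (n−1) a q w = Σ'_y kerP(q,y)·(a·kerQGQ(w,y) − δ_{yw})`. -/
theorem combinedColumn_eq_tsum (ha : 0 < a) (q w : X 4) (v v' : Unit) :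
    a * (∑ z ∈ B (n - 1) w, Pgt n a z q v v') - kerP (d := 4) (n - 1) a q w
      = ∑' y : X 4, kerP (d := 4) (n - 1) a q y * (a * kerQGQ (n - 1) a w y - if y = w then 1 else 0) := by
  classical
  have hs1 : Summable fun y : X 4 => kerP (d := 4) (n - 1) a q y * (a * kerQGQ (n - 1) a w y) := by
    have := (summable_kerP_mul_kerQGQ n ha q w).mul_left a
    refine this.congr fun y => by ring
  have hs2 : Summable fun y : X 4 => kerP (d := 4) (n - 1) a q y * (if y = w then (1 : ℝ) else 0) :=
    summable_of_ne_finset_zero (s := {w}) fun y hy => by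
      rw [Finset.mem_singleton] at hy; rw [if_neg hy, mul_zero]
  have e : ∀ y : X 4, kerP (d := 4) (n - 1) a q y * (a * kerQGQ (n - 1) a w y - if y = w then 1 else 0)
      = kerP (d := 4) (n - 1) a q y * (a * kerQGQ (n - 1) a w y) - kerP (d := 4) (n - 1) a q y * (if y = w then 1 else 0) :=
    fun y => by ring
  simp_rw [e]
  rw [hs1.tsum_sub hs2, sum_B_Pgt_eq_tsum n ha q w v v', kerP_eq_tsum_ite n q w, ← tsum_mul_left]
  congr 1
  exact tsum_congr fun y => by ring

/-! ## §3 Zero mass: the combined column only sees block differences of `kerP(q, ·)` -/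

omit [NeZero n] in
/-- [folklore] The weight `y ↦ a·(Q′G′Q′*)(w,y) − δ_{yw}` is summable (`|Q′G′Q′*| ≤ c_u e^{−δ_u|·|}`). -/
theorem summable_weight (ha : 0 < a) (w : X 4) :
    Summable fun y : X 4 => a * kerQGQ (n - 1) a w y - if y = w then (1 : ℝ) else 0 := by
  classical
  have h1 : Summable fun y : X 4 => a * kerQGQ (n - 1) a w y := by
    refine (Summable.of_norm_bounded ((summable_expX (deltaU_pos 4 ha) w).mul_left (cU 4 a)) fun y => ?_).mul_left a
    rw [Real.norm_eq_abs]
    exact abs_kerQGQ_le_unif (n - 1) ha w y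
  have h2 : Summable fun y : X 4 => if y = w then (1 : ℝ) else 0 :=
    summable_of_ne_finset_zero (s := {w}) fun y hy => by
      rw [Finset.mem_singleton] at hy; rw [if_neg hy]
  exact h1.sub h2

omit [NeZero n] in
/-- [folklore] **ZERO MASS OF THE WEIGHT**: `Σ'_y (a·(Q′G′Q′*)(w,y) − δ_{yw}) = 0` — the row sums of `Q′G′Q′*` are `1/a` (pv23's `tsum_kerQGQ_row`:
`(Δ^η + aQ′*Q′)1 = a·1`). -/
theorem tsum_weight_eq_zero (ha : 0 < a) (w : X 4) :
    ∑' y : X 4, (a * kerQGQ (n - 1) a w y - if y = w then (1 : ℝ) else 0) = 0 := by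
  classical
  have h1 : Summable fun y : X 4 => a * kerQGQ (n - 1) a w y := by
    refine (Summable.of_norm_bounded ((summable_expX (deltaU_pos 4 ha) w).mul_left (cU 4 a)) fun y => ?_).mul_left a
    rw [Real.norm_eq_abs]
    exact abs_kerQGQ_le_unif (n - 1) ha w y
  have h2 : Summable fun y : X 4 => if y = w then (1 : ℝ) else 0 :=
    summable_of_ne_finset_zero (s := {w}) fun y hy => by
      rw [Finset.mem_singleton] at hy; rw [if_neg hy]
  have h3 : ∑' y : X 4, (if y = w then (1 : ℝ) else 0) = 1 := by
    rw [tsum_eq_single w (fun y hy => by rw [if_neg hy]), if_pos rfl]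
  rw [h1.tsum_sub h2, tsum_mul_left, tsum_kerQGQ_row (n - 1) ha w, h3, mul_one_div_cancel ha.ne', sub_self]

omit [NeZero n] in
/-- [folklore] **THE COMBINED COLUMN SEES ONLY BLOCK DIFFERENCES OF `kerP(q,·)`**:
`a·Σ_{z∈B(w)} Pgt n a z q − kerP(q,w) = Σ'_y (kerP(q,y) − kerP(q,w))·(a·kerQGQ(w,y) − δ_{yw})` — one coarse gradient of the exponentially
block-localised `kerP` is gained against the zero-mass weight. -/
theorem combinedColumn_eq_tsum_sub (ha : 0 < a) (q w : X 4) (v v' : Unit) :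
    a * (∑ z ∈ B (n - 1) w, Pgt n a z q v v') - kerP (d := 4) (n - 1) a q w
      = ∑' y : X 4, (kerP (d := 4) (n - 1) a q y - kerP (d := 4) (n - 1) a q w) *
          (a * kerQGQ (n - 1) a w y - if y = w then 1 else 0) := by
  classical
  have hsw := summable_weight n ha w
  have hs0 : Summable fun y : X 4 => kerP (d := 4) (n - 1) a q y * (a * kerQGQ (n - 1) a w y - if y = w then 1 else 0) := by
    have hs1 : Summable fun y : X 4 => kerP (d := 4) (n - 1) a q y * (a * kerQGQ (n - 1) a w y) :=
      ((summable_kerP_mul_kerQGQ n ha q w).mul_left a).congr fun y => by ring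
    have hs2 : Summable fun y : X 4 => kerP (d := 4) (n - 1) a q y * (if y = w then (1 : ℝ) else 0) :=
      summable_of_ne_finset_zero (s := {w}) fun y hy => by
        rw [Finset.mem_singleton] at hy; rw [if_neg hy, mul_zero]
    exact (hs1.sub hs2).congr fun y => by ring
  have e : ∀ y : X 4, (kerP (d := 4) (n - 1) a q y - kerP (d := 4) (n - 1) a q w) * (a * kerQGQ (n - 1) a w y - if y = w then 1 else 0)
      = kerP (d := 4) (n - 1) a q y * (a * kerQGQ (n - 1) a w y - if y = w then 1 else 0)
        - kerP (d := 4) (n - 1) a q w * (a * kerQGQ (n - 1) a w y - if y = w then 1 else 0) := fun y => by ring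
  simp_rw [e]
  rw [hs0.tsum_sub (hsw.mul_left _), tsum_mul_left, tsum_weight_eq_zero n ha w, mul_zero, sub_zero,
    combinedColumn_eq_tsum n ha q w v v']

/-! ## §4 The weight is the Poisson defect of the block column `G′Q′*(·, w)` -/

omit [NeZero n] in
/-- [folklore] **THE WEIGHT IS MINUS THE FINE LAPLACIAN OF THE BLOCK COLUMN, READ ON THE BLOCK**: for every fine site `p` of the block `y`,
`a·(Q′G′Q′*)(w,y) − δ_{yw} = −Σ'_r (n′)²(−Δ)(p,r)·(G′Q′*)(r,w)` (leaf-07-g3's `BlockColumnPoisson.tsum_lap_mul_gq` + symmetry of `Q′G′Q′*`) —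
in particular the right-hand side is BLOCK-CONSTANT in `p`. -/
theorem weight_eq_neg_tsum_lap (ha : 0 < a) (w y p : X 4) (hp : blk (n - 1) p = y) :
    a * kerQGQ (n - 1) a w y - (if y = w then (1 : ℝ) else 0)
      = -∑' r : X 4, ((((n - 1 : ℕ) : ℝ) + 1) ^ 2 * lapKer p r) * gq (n - 1) a r w := by
  rw [tsum_lap_mul_gq (n - 1) ha p w, hp, kerQGQ_symm (n - 1) ha w y]
  ring

omit [NeZero n] in
/-- [folklore] Size of the weight: `|a·(Q′G′Q′*)(w,y) − δ_{yw}| ≤ δ_{yw} + a·c_u·e^{−δ_u·dist(w,y)}` (pv23's mesh-free `abs_kerQGQ_le_unif`). -/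
theorem abs_weight_le (ha : 0 < a) (w y : X 4) :
    |a * kerQGQ (n - 1) a w y - (if y = w then (1 : ℝ) else 0)|
      ≤ (if y = w then (1 : ℝ) else 0) + a * cU 4 a * Real.exp (-(deltaU 4 a * dist w y)) := by
  have h1 : |a * kerQGQ (n - 1) a w y| ≤ a * cU 4 a * Real.exp (-(deltaU 4 a * dist w y)) := by
    rw [abs_mul, abs_of_pos ha, mul_assoc]
    exact mul_le_mul_of_nonneg_left (abs_kerQGQ_le_unif (n - 1) ha w y) ha.le
  have h2 : |(if y = w then (1 : ℝ) else 0)| = if y = w then (1 : ℝ) else 0 := by split_ifs <;> simp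
  calc |a * kerQGQ (n - 1) a w y - (if y = w then (1 : ℝ) else 0)|
      ≤ |a * kerQGQ (n - 1) a w y| + |(if y = w then (1 : ℝ) else 0)| := abs_sub _ _
    _ ≤ _ := by rw [h2]; linarith

/-! ## §5 General weight `cQ`: the excess `(cQ − a)` multiplies the bare block column -/

omit [NeZero n] in
/-- [folklore] For an arbitrary stencil weight `cQ` the combined column splits as `(cQ − a)·Σ_{z∈B(w)} Pgt(z,q)` plus the zero-mass part of §2–§3
(so the exact cancellation structure sits at `cQ = a`; whether the road's `cQ` IS `a` is the owner's units check CHECK-N0, not decided here). -/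
theorem combinedColumn_split (cQ : ℝ) (q w : X 4) (v v' : Unit) :
    cQ * (∑ z ∈ B (n - 1) w, Pgt n a z q v v') - kerP (d := 4) (n - 1) a q w
      = (cQ - a) * (∑ z ∈ B (n - 1) w, Pgt n a z q v v')
        + (a * (∑ z ∈ B (n - 1) w, Pgt n a z q v v') - kerP (d := 4) (n - 1) a q w) := by
  ring

/-! ## §6 Letters of the two columns (block localisation) -/

omit [NeZero n] in
/-- [folklore] **THE BLOCK COLUMN OF THE PROJECTOR IS BLOCK-LOCALISED**: `Σ_{z∈B(w)} |Pgt n a z q| ≤ (n′)⁴·c_PP·e^{−δ_PP·dist(w, blk q)}`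
(`RProjector.abs_Pgt_le` summed over the `(n′)⁴` sites of the block). -/
theorem sum_B_abs_Pgt_le (ha : 0 < a) (q w : X 4) (v v' : Unit) :
    ∑ z ∈ B (n - 1) w, |Pgt n a z q v v'|
      ≤ ((((n - 1 : ℕ) : ℝ) + 1) ^ 4) * (RProjector.cPP 4 (n - 1) a * Real.exp (-(RProjector.deltaPP 4 a * dist w (blk (n - 1) q)))) := by
  calc ∑ z ∈ B (n - 1) w, |Pgt n a z q v v'|
      ≤ ∑ z ∈ B (n - 1) w, RProjector.cPP 4 (n - 1) a * Real.exp (-(RProjector.deltaPP 4 a * dist w (blk (n - 1) q))) := by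
        refine Finset.sum_le_sum fun z hz => ?_
        have h := RProjector.abs_Pgt_le n ha z q v v'
        rwa [mem_B.1 hz] at h
    _ = ((((n - 1 : ℕ) : ℝ) + 1) ^ 4) * (RProjector.cPP 4 (n - 1) a * Real.exp (-(RProjector.deltaPP 4 a * dist w (blk (n - 1) q)))) :=
        B6QGQLower276.sum_B_const w _

omit [NeZero n] in
/-- [folklore] The absolute value of the block column is bounded by the same quantity. -/
theorem abs_sum_B_Pgt_le (ha : 0 < a) (q w : X 4) (v v' : Unit) :
    |∑ z ∈ B (n - 1) w, Pgt n a z q v v'|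
      ≤ ((((n - 1 : ℕ) : ℝ) + 1) ^ 4) * (RProjector.cPP 4 (n - 1) a * Real.exp (-(RProjector.deltaPP 4 a * dist w (blk (n - 1) q)))) :=
  (Finset.abs_sum_le_sum_abs _ _).trans (sum_B_abs_Pgt_le n ha q w v v')

omit [NeZero n] in
/-- [folklore] **THE `kerP` COLUMN IS BLOCK-LOCALISED** (leaf-09-g2's `abs_kerP_le`, restated in the road's block currency for the reader's convenience):
`|kerP (n−1) a q w| ≤ c_P·e^{−δ_P·dist(blk q, w)}`. -/
theorem abs_kerP_col_le (ha : 0 < a) (q w : X 4) :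
    |kerP (d := 4) (n - 1) a q w| ≤ RProjector.cP 4 (n - 1) a * Real.exp (-(RProjector.deltaP 4 a * dist (blk (n - 1) q) w)) :=
  RProjector.abs_kerP_le (n - 1) ha q w

end

end Summit.QuantumFields.BalabanUV.Beta.D1BFx.CornerColumnZeroMass
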